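import Literature.Analysis.FluidPDE.FluidComputer.ClassicalLatticeSpectra

/-!
# The truncated 3D Euler system does NOT conserve enstrophy: an explicit three-wave witness with `T_Z = 2`

GalerkinEnergyBalance (v3) proves the enstrophy equation of the truncated system,
`dZ_S/dt = -2νP_S + T_Z + inj` with `T_Z = enstrophyTransfer = Σ_{k∈S} |k|² T(k)`, and that `T_Z = 0` at
every SINGLE-SHELL instant (`enstrophyTransfer_eq_zero_of_singleShell`): all three classical lattice data
(TG, KP, ABC) start with a flat Euler enstrophy curve. That is a property of single shells, not of the
system: unlike the energy (`sum_energyRate_eq_zero`) and the helicity (HelicityBalance), the enstrophy is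
NOT an invariant of the three-dimensional truncated Euler dynamics. This file gives the smallest witness we
know, by exact arithmetic on six modes:

* `ThreeWaves.tw` — the real, divergence-free coefficient field `û(±e₁) = (0,0,1)`, `û(±e₂) = (1,0,0)`,
  `û(±(e₁+e₂)) = (0,0,∓i)`, zero elsewhere (the velocity field `u = (2cos y, 0, 2cos x + 2sin(x+y))`, a
  superposition of three shear waves, each by itself a steady Euler solution), carried by the box
  `B = {0,±1}×{0,±1}×{0}`;
* `truncEnergy_tw : E_S = 3`, `truncEnstrophy_tw : Z_S = 4`, `truncPalinstrophy_tw : P_S = 6` on every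
  mode set `S ⊇ B`;
* **`enstrophyTransfer_tw : T_Z = 2`** on every mode set `S ⊇ B` (two shells `|k|² = 1, 2`: the modes
  `±(e₁+e₂)` gain energy at rate `1` each, `±e₁` lose `1` each, `±e₂` are neutral; `Σ T(k) = 0` as it must,
  `Σ |k|² T(k) = 2·2 - 1·2 = 2`);
* **`hasDerivAt_truncEnstrophy_tw`**: along ANY unforced Galerkin solution on `S ⊇ B` passing through `tw`
  at time `t₀`, `dZ_S/dt (t₀) = 2 - 12ν` — positive for every `ν < 1/6`, and `= 2` for truncated Euler
  (`hasDerivAt_truncEnstrophy_tw_euler`): the enstrophy is instantaneously INCREASING, so it is not conserved.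

[folklore: in three dimensions vortex stretching `⟨ω·S·ω⟩` changes the enstrophy; only in two dimensions is
the enstrophy a second quadratic invariant of every Galerkin truncation (Kraichnan 1967, Lee 1952) — the 2D
statement is not formalised here.] Use (cell pub-fluidc): a typed non-vacuity check for the enstrophy
production term both engines report (opt-adj's objective, the atlas's growth diagnostics): `T_Z` is a
genuinely non-trivial functional of the truncated field, already on two shells. 0 sorry, 0 named facts
(D-0026). HONEST FRAMING: typed infrastructure for a low prior, high value-of-information experiment on
Tao's machine paradigm; NOT a claim that NS blows up.
-/

noncomputable section

namespace Literature.Analysis.FluidPDE.FluidComputer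

open Complex ComplexConjugate Finset
open scoped BigOperators

namespace ShellTransfer

namespace ThreeWaves

open KidaPelzHat (box mem_box sum_box)

/-! ## The support box `{0,±1} × {0,±1} × {0}` -/

/-- `{0, 1, -1} ⊂ ℤ`. [folklore] -/
def zpm : Finset ℤ := {0, 1, -1}

/-- Membership. [folklore] -/
theorem mem_zpm {a : ℤ} : a ∈ zpm ↔ a = 0 ∨ a = 1 ∨ a = -1 := by
  unfold zpm; simp

/-- Symmetry. [folklore] -/
theorem neg_mem_zpm {a : ℤ} (h : a ∈ zpm) : -a ∈ zpm := by
  rcases mem_zpm.mp h with rfl | rfl | rfl <;> decide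

/-- `Σ_{a∈{0,1,-1}} h a = h 0 + h 1 + h (-1)`. [folklore] -/
theorem sum_zpm {M : Type*} [AddCommMonoid M] (h : ℤ → M) : ∑ a ∈ zpm, h a = h 0 + h 1 + h (-1) := by
  unfold zpm
  rw [Finset.sum_insert (by decide), Finset.sum_pair (by decide), add_assoc]

/-- The support box `B = {0,±1} × {0,±1} × {0}` (nine wavevectors, six of which carry the field). [folklore] -/
def B : Finset (Fin 3 → ℤ) := box zpm zpm {0}

/-- Membership in `B`. [folklore] -/
theorem mem_B {k : Fin 3 → ℤ} : k ∈ B ↔ k 0 ∈ zpm ∧ k 1 ∈ zpm ∧ k 2 = 0 := by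
  unfold B
  rw [mem_box, Finset.mem_singleton]

/-- `B` is symmetric. [folklore] -/
theorem neg_mem_B {k : Fin 3 → ℤ} (h : k ∈ B) : -k ∈ B := by
  obtain ⟨h0, h1, h2⟩ := mem_B.mp h
  refine mem_B.mpr ⟨?_, ?_, ?_⟩
  · simpa using neg_mem_zpm h0
  · simpa using neg_mem_zpm h1
  · simp [h2]

/-- Sums over `B` are double sums. [folklore] -/
theorem sum_B {M : Type*} [AddCommMonoid M] (g : (Fin 3 → ℤ) → M) :
    ∑ k ∈ B, g k = ∑ a ∈ zpm, ∑ b ∈ zpm, g ![a, b, 0] := by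
  unfold B
  rw [sum_box]
  refine Finset.sum_congr rfl fun a _ => Finset.sum_congr rfl fun b _ => ?_
  rw [Finset.sum_singleton]

/-- A vector with entries in `zpm × zpm × {0}` lies in `B`. [folklore] -/
theorem vec_mem_B {a b : ℤ} (ha : a ∈ zpm) (hb : b ∈ zpm) : (![a, b, 0] : Fin 3 → ℤ) ∈ B :=
  mem_B.mpr ⟨by simpa using ha, by simpa using hb, by simp⟩

/-! ## The three-wave field -/

/-- The coefficient vector at `k = (a, b, 0)`: `(0,0,1)` on `±e₁`, `(1,0,0)` on `±e₂`, `(0,0,-ia)` on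
`±(e₁+e₂)`, zero on `0` and `±(e₁-e₂)`. [folklore] -/
def vecFun (a b : ℤ) : Fin 3 → ℂ :=
  if b = 0 ∧ a ≠ 0 then ![0, 0, 1]
  else if a = 0 ∧ b ≠ 0 then ![1, 0, 0]
  else if a = b ∧ a ≠ 0 then ![0, 0, -I * (a : ℂ)]
  else 0

/-- The coefficients `û(k)`: `vecFun (k 0) (k 1)` on `B`, zero elsewhere. [folklore] -/
def coeffFun (k : Fin 3 → ℤ) (j : Fin 3) : ℂ := if k ∈ B then vecFun (k 0) (k 1) j else 0

/-- **The three-wave witness** `u = (2cos y, 0, 2cos x + 2 sin(x+y))` as a `FourierVelocity` (real and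
divergence-free in Fourier space). [folklore] -/
def tw : FourierVelocity where
  coeff := coeffFun
  reality k i := by
    unfold coeffFun
    by_cases hk : k ∈ B
    · rw [if_pos (neg_mem_B hk), if_pos hk]
      obtain ⟨h0, h1, -⟩ := mem_B.mp hk
      simp only [Pi.neg_apply]
      rcases mem_zpm.mp h0 with e0 | e0 | e0 <;> rcases mem_zpm.mp h1 with e1 | e1 | e1 <;>
        rw [e0, e1] <;> fin_cases i <;> norm_num [vecFun]
    · have hnk : -k ∉ B := fun h => hk (by simpa using neg_mem_B h)
      rw [if_neg hnk, if_neg hk, map_zero]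
  divFree k := by
    unfold coeffFun
    by_cases hk : k ∈ B
    · obtain ⟨h0, h1, h2⟩ := mem_B.mp hk
      simp only [if_pos hk, Fin.sum_univ_three, h2, Int.cast_zero, zero_mul, add_zero]
      rcases mem_zpm.mp h0 with e0 | e0 | e0 <;> rcases mem_zpm.mp h1 with e1 | e1 | e1 <;>
        rw [e0, e1] <;> norm_num [vecFun]
    · simp [if_neg hk]

/-- The coefficients as a single `if`. [folklore] -/
theorem coeff_eq_ite (k : Fin 3 → ℤ) (j : Fin 3) :
    tw.coeff k j = if k ∈ B then vecFun (k 0) (k 1) j else 0 := rfl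

/-- Off the box the field vanishes. [folklore] -/
theorem coeff_of_not_mem {k : Fin 3 → ℤ} (hk : k ∉ B) : tw.coeff k = 0 := by
  funext j
  rw [coeff_eq_ite, if_neg hk, Pi.zero_apply]

/-! ## Exact quadratic diagnostics: `E_S = 3`, `Z_S = 4`, `P_S = 6` -/

/-- `E_B = 3`. [folklore] -/
theorem truncEnergy_tw_B : truncEnergy tw B = 3 := by
  unfold truncEnergy modalEnergy
  rw [sum_B]
  simp only [sum_zpm, Fin.sum_univ_three, coeff_eq_ite]
  norm_num [vecFun, mem_B, mem_zpm, Matrix.cons_val_zero, Matrix.cons_val_one, Matrix.head_cons,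
    Matrix.cons_val_two, Matrix.tail_cons, Complex.normSq_apply]

/-- `Z_B = 4`. [folklore] -/
theorem truncEnstrophy_tw_B : truncEnstrophy tw B = 4 := by
  unfold truncEnstrophy modalEnergy knormSq
  rw [sum_B]
  simp only [sum_zpm, Fin.sum_univ_three, coeff_eq_ite]
  norm_num [vecFun, mem_B, mem_zpm, Matrix.cons_val_zero, Matrix.cons_val_one, Matrix.head_cons,
    Matrix.cons_val_two, Matrix.tail_cons, Complex.normSq_apply]

/-- `P_B = 6`. [folklore] -/
theorem truncPalinstrophy_tw_B : truncPalinstrophy tw B = 6 := by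
  unfold truncPalinstrophy modalEnergy knormSq
  rw [sum_B]
  simp only [sum_zpm, Fin.sum_univ_three, coeff_eq_ite]
  norm_num [vecFun, mem_B, mem_zpm, Matrix.cons_val_zero, Matrix.cons_val_one, Matrix.head_cons,
    Matrix.cons_val_two, Matrix.tail_cons, Complex.normSq_apply]

/-- `E_S = 3` on every mode set containing `B`. [folklore] -/
theorem truncEnergy_tw {S : Finset (Fin 3 → ℤ)} (hS : B ⊆ S) : truncEnergy tw S = 3 := by
  rw [← truncEnergy_tw_B]
  unfold truncEnergy
  symm
  refine Finset.sum_subset hS fun k _ hk => ?_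
  exact modalEnergy_eq_zero_of_coeff tw (coeff_of_not_mem hk)

/-- `Z_S = 4` on every mode set containing `B`. [folklore] -/
theorem truncEnstrophy_tw {S : Finset (Fin 3 → ℤ)} (hS : B ⊆ S) : truncEnstrophy tw S = 4 := by
  rw [← truncEnstrophy_tw_B]
  unfold truncEnstrophy
  symm
  refine Finset.sum_subset hS fun k _ hk => ?_
  rw [modalEnergy_eq_zero_of_coeff tw (coeff_of_not_mem hk), mul_zero]

/-- `P_S = 6` on every mode set containing `B`. [folklore] -/
theorem truncPalinstrophy_tw {S : Finset (Fin 3 → ℤ)} (hS : B ⊆ S) : truncPalinstrophy tw S = 6 := by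
  rw [← truncPalinstrophy_tw_B]
  unfold truncPalinstrophy
  symm
  refine Finset.sum_subset hS fun k _ hk => ?_
  rw [modalEnergy_eq_zero_of_coeff tw (coeff_of_not_mem hk), mul_zero]

/-! ## The enstrophy production `T_Z = 2` -/

/-- A transfer FROM a mode with zero coefficient vanishes. [folklore] -/
theorem modeTransfer_eq_zero_of_coeff_right (U : FourierVelocity) (k : Fin 3 → ℤ) {p : Fin 3 → ℤ}
    (hp : U.coeff p = 0) : modeTransfer U k p = 0 := by
  unfold modeTransfer cdot
  simp [hp]

/-- The modal energy rates of `tw` inside any mode set containing `B` are those inside `B`. [folklore] -/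
theorem energyRate_tw_eq {S : Finset (Fin 3 → ℤ)} (hS : B ⊆ S) (k : Fin 3 → ℤ) :
    energyRate tw S k = energyRate tw B k := by
  unfold energyRate
  symm
  refine Finset.sum_subset hS fun p _ hp => ?_
  exact modeTransfer_eq_zero_of_coeff_right tw k (coeff_of_not_mem hp)

set_option maxHeartbeats 4000000 in
/-- **`T_Z(tw) = 2` on the box**: the 81 mode pairs by exact arithmetic. [folklore] -/
theorem enstrophyTransfer_tw_B : enstrophyTransfer tw B = 2 := by
  unfold enstrophyTransfer energyRate
  rw [sum_B]
  simp only [sum_B, sum_zpm]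
  norm_num [modeTransfer, kdot, cdot, knormSq, Fin.sum_univ_three, coeff_eq_ite, vecFun, mem_B, mem_zpm,
    Pi.sub_apply, Matrix.cons_val_zero, Matrix.cons_val_one, Matrix.head_cons, Matrix.cons_val_two,
    Matrix.tail_cons, Complex.ext_iff]

/-- **ENSTROPHY PRODUCTION OF THE THREE-WAVE FIELD: `T_Z = 2`** on every mode set containing its support.
[folklore] -/
theorem enstrophyTransfer_tw {S : Finset (Fin 3 → ℤ)} (hS : B ⊆ S) : enstrophyTransfer tw S = 2 := by
  rw [← enstrophyTransfer_tw_B]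
  unfold enstrophyTransfer
  rw [Finset.sum_congr rfl fun k _ => by rw [energyRate_tw_eq hS k]]
  symm
  refine Finset.sum_subset hS fun k _ hk => ?_
  rw [energyRate_eq_zero_of_coeff tw B (coeff_of_not_mem hk), mul_zero]

/-! ## The enstrophy is instantaneously increasing through `tw` -/

/-- **`dZ_S/dt = 2 - 12ν` through the three-wave field.** Along any unforced Galerkin solution on a mode set
`S ⊇ B` (any viscosity `ν`, any pressure multiplier) that passes through `tw` at time `t₀`, the truncated
enstrophy has derivative `-2ν·P_S + T_Z = -12ν + 2` at `t₀`; in particular it is INCREASING for `ν < 1/6`.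
[folklore] -/
theorem hasDerivAt_truncEnstrophy_tw {U : ℝ → FourierVelocity} {S : Finset (Fin 3 → ℤ)} {ν : ℝ}
    {c : ℝ → (Fin 3 → ℤ) → ℂ} (hU : IsGalerkinSolution U S ν c fun _ _ _ => 0) (hS : B ⊆ S) {t₀ : ℝ}
    (h0 : U t₀ = tw) : HasDerivAt (fun s => truncEnstrophy (U s) S) (2 - 12 * ν) t₀ := by
  have h := hasDerivAt_truncEnstrophy_galerkin hU t₀
  rw [h0, truncPalinstrophy_tw hS, enstrophyTransfer_tw hS] at h
  have hinj : enstrophyInjection tw ((fun (_ : ℝ) (_ : Fin 3 → ℤ) (_ : Fin 3) => (0 : ℂ)) t₀) S = 0 := by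
    unfold enstrophyInjection cdot
    simp
  rw [hinj, add_zero] at h
  refine h.congr_deriv ?_
  ring

/-- **THE TRUNCATED EULER SYSTEM DOES NOT CONSERVE ENSTROPHY**: through `tw`, `dZ_S/dt = 2 ≠ 0`.
[folklore] -/
theorem hasDerivAt_truncEnstrophy_tw_euler {U : ℝ → FourierVelocity} {S : Finset (Fin 3 → ℤ)}
    {c : ℝ → (Fin 3 → ℤ) → ℂ} (hU : IsGalerkinSolution U S 0 c fun _ _ _ => 0) (hS : B ⊆ S) {t₀ : ℝ}
    (h0 : U t₀ = tw) : HasDerivAt (fun s => truncEnstrophy (U s) S) 2 t₀ := by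
  have h := hasDerivAt_truncEnstrophy_tw hU hS h0
  simpa using h

end ThreeWaves

end ShellTransfer

end Literature.Analysis.FluidPDE.FluidComputer

end
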